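import Literature.NumberTheory.EllipticCurves.IwasawaSelmerDualFunctorialityProofs
import Literature.NumberTheory.EllipticCurves.IwasawaOrderKernelRankProofs
import Literature.NumberTheory.EllipticCurves.IwasawaAlgebraInvolutionEvenLambdaProofs
import Mathlib.LinearAlgebra.TensorProduct.Prod
import HarnessLib

/-!
# A comparison of Pontryagin duals with `p`-power-bounded kernel and cokernel preserves the
# `λ`-invariant and `Λ`-torsion: `λ(X₂) = λ(X₁) + λ(X₁′)` (THEOREMS only; no definition, no named fact)

Sequel of `IwasawaSelmerDualFunctorialityProofs` (the transpose `Φ^∨ = IwasawaDual.dualHom` of an additive map of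
discrete `p`-primary groups through bijective «dual data» `toDualᵢ : Xᵢ ≅ Hom(Sᵢ, ℚ/ℤ)`, and the transfer of
kernel/cokernel bounds).  For a two-map comparison `(s, s′) ↦ Φ s + Φ′ s′ : S₁ × S₁′ → S₂` whose kernel is killed by
`p^j` and whose image contains `p^j · S₂`, the transpose `X₂ → X₁ × X₁′`, `x ↦ (Φ^∨ x, Φ′^∨ x)`, is `ℤ_p`-LINEAR for
the `ℤ_p`-structures through the constants `C : ℤ_p → Λ` (by the `C`-compatibility axiom of the dual data,
`toDual (C c • x) s = c̄ • toDual x s` on `p^k`-torsion classes — NO compatibility of `Φ` with the `Λ`-structures is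
needed) and has `p`-power-torsion kernel and cokernel; tensoring with the flat `ℤ_p`-algebra `ℚ_p` kills both
(tree `Module.bijective_baseChange_of_pow_smul`), so `ℚ_p ⊗ X₂ ≅ ℚ_p ⊗ X₁ × ℚ_p ⊗ X₁′`.  Since the tree's
`lambdaInvariant p X` IS `dim_{ℚ_p}(ℚ_p ⊗_{ℤ_p} X)` (Washington §13.2), and a `Λ`-module with finite-dimensional
`ℚ_p ⊗ X` is torsion (`IwasawaAlgebra.isTorsion_of_finite_baseChange`):

* §1 `dualHom_C_smul` — `Φ^∨ (C c • x) = C c • Φ^∨ x`.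
* §2 **`isTorsion_and_lambdaInvariant_eq_add_of_comparison`** — if `X₁`, `X₁′` are finitely generated torsion
  `Λ`-modules then `X₂` is `Λ`-torsion and `λ(X₂) = λ(X₁) + λ(X₁′)`; one-map version
  `isTorsion_and_lambdaInvariant_eq_of_comparison` (`λ(X₂) = λ(X₁)`).

`μ` is NOT preserved (bounded `p`-power torsion is invisible to `ℚ_p ⊗ ·` but not to `μ`).  Motivation (cell `bsd-2adic`,
seat `conv-1` GEN 32, crux stmt-BirchSwinnertonDyer-19556, binder (S) `LambdaShapiroFineAtTwo`): the fine Selmer groups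
along the quadratic layer `K_∞/ℚ_∞` (`K` imaginary quadratic), `Sel₀(ℚ_∞, E) × Sel₀(ℚ_∞, E^{(d_K)}) → Sel₀(K_∞, E)`,
kernel and cokernel killed by `4`; that application is NOT made here.

## References

* [Washington1997] L. C. Washington, *Introduction to Cyclotomic Fields*, 2nd ed., §13.2 (`λ = rank_{ℤ_p}`; Pontryagin duality).
* [DokchitserDokchitserAnnals2010] T. Dokchitser, V. Dokchitser, Ann. of Math. 172 (2010), Lemma 4.14 (kernel/cokernel killed by `|G|²`).
* [GreenbergLNM1716] R. Greenberg, LNM 1716 (1999), §1 (p. 60) (the `Λ`-structure of the duals).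
-/

noncomputable section

open scoped Classical TensorProduct

universe u

namespace Literature.NumberTheory.EllipticCurves

namespace IwasawaDual

open IwasawaAlgebra

variable {p : ℕ} [Fact p.Prime]

/-! ## §1 `Φ^∨` commutes with the constants `C c` -/

section Constants

variable {S₁ S₂ : Type*} [AddCommGroup S₁] [AddCommGroup S₂]
  {X₁ : Type*} [AddCommGroup X₁] [Module (IwasawaAlgebra p) X₁]
  {X₂ : Type*} [AddCommGroup X₂] [Module (IwasawaAlgebra p) X₂]
  (toDual₁ : X₁ →+ (S₁ →+ AddCircle (1 : ℚ))) (hbij₁ : Function.Bijective toDual₁)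
  (toDual₂ : X₂ →+ (S₂ →+ AddCircle (1 : ℚ))) (Φ : S₁ →+ S₂)
  (hS₁ : ∀ s : S₁, ∃ k : ℕ, p ^ k • s = 0)
  (hC₁ : ∀ (c : ℤ_[p]) (x : X₁) (s : S₁) (k : ℕ), p ^ k • s = 0 →
    toDual₁ (PowerSeries.C c • x) s = (PadicInt.toZModPow k c).val • toDual₁ x s)
  (hC₂ : ∀ (c : ℤ_[p]) (x : X₂) (s : S₂) (k : ℕ), p ^ k • s = 0 →
    toDual₂ (PowerSeries.C c • x) s = (PadicInt.toZModPow k c).val • toDual₂ x s)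

include hS₁ hC₁ hC₂ in
/-- **`Φ^∨ (C c • x) = C c • Φ^∨ x`**: the transpose is linear for the constants `c ∈ ℤ_p`, for ANY additive `Φ`
between `p`-primary groups — both dual data let `C c` act on a `p^k`-torsion class `s` as the integer `c mod p^k`
(`toDual_C_smul`), and `Φ` preserves `p^k s = 0`. [cite: Washington1997, §13.2] -/
theorem dualHom_C_smul (c : ℤ_[p]) (x : X₂) :
    dualHom toDual₁ hbij₁ toDual₂ Φ (PowerSeries.C c • x) = PowerSeries.C c • dualHom toDual₁ hbij₁ toDual₂ Φ x := by
  apply hbij₁.1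
  ext s
  obtain ⟨k, hk⟩ := hS₁ s
  have hk' : p ^ k • Φ s = 0 := by rw [← map_nsmul, hk, map_zero]
  rw [toDual_dualHom_apply, hC₂ c x (Φ s) k hk', hC₁ c _ s k hk, toDual_dualHom_apply]

end Constants

/-! ## §2 `ℚ_p ⊗ X₂ ≅ ℚ_p ⊗ X₁ × ℚ_p ⊗ X₁′`; torsion and `λ` -/

section Comparison

variable {S₁ S₁' S₂ : Type*} [AddCommGroup S₁] [AddCommGroup S₁'] [AddCommGroup S₂]
  {X₁ : Type*} [AddCommGroup X₁] [Module (IwasawaAlgebra p) X₁]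
  {X₁' : Type*} [AddCommGroup X₁'] [Module (IwasawaAlgebra p) X₁']
  {X₂ : Type*} [AddCommGroup X₂] [Module (IwasawaAlgebra p) X₂]
  (toDual₁ : X₁ →+ (S₁ →+ AddCircle (1 : ℚ))) (hbij₁ : Function.Bijective toDual₁)
  (toDual₁' : X₁' →+ (S₁' →+ AddCircle (1 : ℚ))) (hbij₁' : Function.Bijective toDual₁')
  (toDual₂ : X₂ →+ (S₂ →+ AddCircle (1 : ℚ))) (hbij₂ : Function.Bijective toDual₂)
  (Φ : S₁ →+ S₂) (Φ' : S₁' →+ S₂)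
  (hS₁ : ∀ s : S₁, ∃ k : ℕ, p ^ k • s = 0) (hS₁' : ∀ s : S₁', ∃ k : ℕ, p ^ k • s = 0)
  (hC₁ : ∀ (c : ℤ_[p]) (x : X₁) (s : S₁) (k : ℕ), p ^ k • s = 0 →
    toDual₁ (PowerSeries.C c • x) s = (PadicInt.toZModPow k c).val • toDual₁ x s)
  (hC₁' : ∀ (c : ℤ_[p]) (x : X₁') (s : S₁') (k : ℕ), p ^ k • s = 0 →
    toDual₁' (PowerSeries.C c • x) s = (PadicInt.toZModPow k c).val • toDual₁' x s)
  (hC₂ : ∀ (c : ℤ_[p]) (x : X₂) (s : S₂) (k : ℕ), p ^ k • s = 0 →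
    toDual₂ (PowerSeries.C c • x) s = (PadicInt.toZModPow k c).val • toDual₂ x s)

include hbij₁ hbij₁' hbij₂ hS₁ hS₁' hC₁ hC₁' hC₂ in
/-- **Comparison theorem for Pontryagin duals.** Let `(s, s′) ↦ Φ s + Φ′ s′ : S₁ × S₁′ → S₂` have kernel killed by
`p^j` and image containing `p^j · S₂` (`Sᵢ` `p`-primary, `Xᵢ ≅ Hom(Sᵢ, ℚ/ℤ)` dual data with the `C`-compatibility).
If `X₁`, `X₁′` are finitely generated torsion `Λ`-modules, then **`X₂` is `Λ`-torsion and
`λ(X₂) = λ(X₁) + λ(X₁′)`**: the `ℤ_p`-linear transpose `X₂ → X₁ × X₁′` has `p^j`-torsion kernel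
(`smul_eq_zero_of_dualHom_eq_zero₂`) and cokernel (`exists_dualHom_pair_eq_smul`), so it becomes an isomorphism after
`ℚ_p ⊗_{ℤ_p} ·` (`Module.bijective_baseChange_of_pow_smul`); `λ = dim_{ℚ_p}(ℚ_p ⊗ ·)` and finite dimension forces
torsion (`isTorsion_of_finite_baseChange`). [cite: Washington1997, §13.2] [cite: DokchitserDokchitserAnnals2010, Lemma 4.14 (proof)] -/
theorem isTorsion_and_lambdaInvariant_eq_add_of_comparison {j : ℕ}
    (hker : ∀ (s : S₁) (s' : S₁'), Φ s + Φ' s' = 0 → p ^ j • s = 0 ∧ p ^ j • s' = 0)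
    (hcoker : ∀ t : S₂, ∃ (s : S₁) (s' : S₁'), Φ s + Φ' s' = p ^ j • t)
    [Module.Finite (IwasawaAlgebra p) X₁] [Module.Finite (IwasawaAlgebra p) X₁']
    (hX₁ : Module.IsTorsion (IwasawaAlgebra p) X₁) (hX₁' : Module.IsTorsion (IwasawaAlgebra p) X₁') :
    Module.IsTorsion (IwasawaAlgebra p) X₂ ∧
      lambdaInvariant p X₂ = lambdaInvariant p X₁ + lambdaInvariant p X₁' := by
  -- the `ℤ_p`-structures through `C : ℤ_p → Λ`
  letI i₁ : Module ℤ_[p] X₁ := Module.compHom X₁ (algebraMap ℤ_[p] (IwasawaAlgebra p))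
  letI i₁' : Module ℤ_[p] X₁' := Module.compHom X₁' (algebraMap ℤ_[p] (IwasawaAlgebra p))
  letI i₂ : Module ℤ_[p] X₂ := Module.compHom X₂ (algebraMap ℤ_[p] (IwasawaAlgebra p))
  haveI : IsScalarTower ℤ_[p] (IwasawaAlgebra p) X₁ := IsScalarTower.of_compHom ℤ_[p] _ _
  haveI : IsScalarTower ℤ_[p] (IwasawaAlgebra p) X₁' := IsScalarTower.of_compHom ℤ_[p] _ _
  haveI : IsScalarTower ℤ_[p] (IwasawaAlgebra p) X₂ := IsScalarTower.of_compHom ℤ_[p] _ _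
  haveI : Module.Flat ℤ_[p] ℚ_[p] := IsLocalization.flat ℚ_[p] (nonZeroDivisors ℤ_[p])
  have hsmul₁ : ∀ (c : ℤ_[p]) (y : X₁), c • y = PowerSeries.C c • y := fun _ _ ↦ rfl
  have hsmul₁' : ∀ (c : ℤ_[p]) (y : X₁'), c • y = PowerSeries.C c • y := fun _ _ ↦ rfl
  have hsmul₂ : ∀ (c : ℤ_[p]) (y : X₂), c • y = PowerSeries.C c • y := fun _ _ ↦ rfl
  -- the transpose `F : X₂ → X₁ × X₁'`
  let F₀ : X₂ →+ X₁ × X₁' :=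
    (dualHom toDual₁ hbij₁ toDual₂ Φ).prod (dualHom toDual₁' hbij₁' toDual₂ Φ')
  have hF₀ : ∀ x, F₀ x = (dualHom toDual₁ hbij₁ toDual₂ Φ x, dualHom toDual₁' hbij₁' toDual₂ Φ' x) :=
    fun _ ↦ rfl
  let F : X₂ →ₗ[ℤ_[p]] X₁ × X₁' :=
    { F₀ with
      map_smul' := fun c x ↦ by
        change F₀ (c • x) = c • F₀ x
        rw [hF₀, hF₀, hsmul₂, Prod.smul_mk, hsmul₁, hsmul₁',
          dualHom_C_smul toDual₁ hbij₁ toDual₂ Φ hS₁ hC₁ hC₂,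
          dualHom_C_smul toDual₁' hbij₁' toDual₂ Φ' hS₁' hC₁' hC₂] }
  have hF : ∀ x, F x = (dualHom toDual₁ hbij₁ toDual₂ Φ x, dualHom toDual₁' hbij₁' toDual₂ Φ' x) :=
    fun _ ↦ rfl
  have hpj₁ : ∀ y : X₁, (p : ℤ_[p]) ^ j • y = p ^ j • y := fun y ↦ by
    rw [← Nat.cast_pow, Nat.cast_smul_eq_nsmul]
  have hpj₁' : ∀ y : X₁', (p : ℤ_[p]) ^ j • y = p ^ j • y := fun y ↦ by
    rw [← Nat.cast_pow, Nat.cast_smul_eq_nsmul]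
  have hpj₂ : ∀ y : X₂, (p : ℤ_[p]) ^ j • y = p ^ j • y := fun y ↦ by
    rw [← Nat.cast_pow, Nat.cast_smul_eq_nsmul]
  -- kernel and cokernel of `F` are killed by `p^j`
  have hkerF : ∀ x, F x = 0 → ∃ n : ℕ, (p : ℤ_[p]) ^ n • x = 0 := by
    intro x hx
    rw [hF, Prod.mk_eq_zero] at hx
    refine ⟨j, ?_⟩
    rw [hpj₂]
    exact smul_eq_zero_of_dualHom_eq_zero₂ toDual₁ hbij₁ toDual₂ hbij₂ Φ toDual₁' hbij₁' Φ' hcoker hx.1 hx.2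
  have hcokerF : ∀ y : X₁ × X₁', ∃ (n : ℕ) (x : X₂), (p : ℤ_[p]) ^ n • y = F x := by
    rintro ⟨y, y'⟩
    obtain ⟨x, hx, hx'⟩ := exists_dualHom_pair_eq_smul toDual₁ hbij₁ toDual₂ hbij₂ Φ toDual₁' hbij₁' Φ' hker y y'
    refine ⟨j, x, ?_⟩
    rw [hF, hx, hx', Prod.smul_mk, hpj₁, hpj₁']
  have hbij := Module.bijective_baseChange_of_pow_smul ℚ_[p] (isUnit_algebraMap_p p) F hkerF hcokerF
  let e : ℚ_[p] ⊗[ℤ_[p]] X₂ ≃ₗ[ℚ_[p]] ℚ_[p] ⊗[ℤ_[p]] (X₁ × X₁') := LinearEquiv.ofBijective _ hbij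
  let e' : ℚ_[p] ⊗[ℤ_[p]] (X₁ × X₁') ≃ₗ[ℚ_[p]] (ℚ_[p] ⊗[ℤ_[p]] X₁) × (ℚ_[p] ⊗[ℤ_[p]] X₁') :=
    TensorProduct.prodRight ℤ_[p] ℚ_[p] ℚ_[p] X₁ X₁'
  haveI : Module.Finite ℚ_[p] (ℚ_[p] ⊗[ℤ_[p]] X₁) := finite_baseChange_of_isTorsion p hX₁
  haveI : Module.Finite ℚ_[p] (ℚ_[p] ⊗[ℤ_[p]] X₁') := finite_baseChange_of_isTorsion p hX₁'
  haveI : Module.Finite ℚ_[p] (ℚ_[p] ⊗[ℤ_[p]] X₂) := Module.Finite.equiv (e.trans e').symm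
  refine ⟨isTorsion_of_finite_baseChange p, ?_⟩
  rw [lambdaInvariant_eq_finrank_tensorProduct, lambdaInvariant_eq_finrank_tensorProduct,
    lambdaInvariant_eq_finrank_tensorProduct, (e.trans e').finrank_eq, Module.finrank_prod]

include hbij₁ hbij₂ hS₁ hC₁ hC₂ in
/-- **One-map version**: if `Φ : S₁ → S₂` has kernel killed by `p^j` and image containing `p^j · S₂`, and `X₁` is a
finitely generated torsion `Λ`-module, then `X₂` is `Λ`-torsion and `λ(X₂) = λ(X₁)` (take `S₁′ = 0`).
[cite: Washington1997, §13.2] [cite: DokchitserDokchitserAnnals2010, Lemma 4.14 (proof)] -/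
theorem isTorsion_and_lambdaInvariant_eq_of_comparison {j : ℕ}
    (hker : ∀ s : S₁, Φ s = 0 → p ^ j • s = 0) (hcoker : ∀ t : S₂, ∃ s : S₁, Φ s = p ^ j • t)
    [Module.Finite (IwasawaAlgebra p) X₁] (hX₁ : Module.IsTorsion (IwasawaAlgebra p) X₁) :
    Module.IsTorsion (IwasawaAlgebra p) X₂ ∧ lambdaInvariant p X₂ = lambdaInvariant p X₁ := by
  -- the zero partner `S₁' = X₁' = 0`
  let toDual₀ : (PUnit : Type) →+ ((PUnit : Type) →+ AddCircle (1 : ℚ)) := 0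
  have hbij₀ : Function.Bijective toDual₀ :=
    ⟨fun a b _ ↦ Subsingleton.elim a b, fun y ↦ ⟨PUnit.unit, by
      ext s
      rw [show s = 0 from Subsingleton.elim _ _, map_zero, map_zero]⟩⟩
  have h := isTorsion_and_lambdaInvariant_eq_add_of_comparison (X₁' := (PUnit : Type)) (S₁' := (PUnit : Type))
    toDual₁ hbij₁ toDual₀ hbij₀ toDual₂ hbij₂ Φ (0 : (PUnit : Type) →+ S₂) hS₁
    (fun _ ↦ ⟨0, Subsingleton.elim _ _⟩) hC₁
    (fun c x s k _ ↦ by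
      change (0 : (PUnit : Type) →+ AddCircle (1 : ℚ)) s = _ • (0 : (PUnit : Type) →+ AddCircle (1 : ℚ)) s
      rw [AddMonoidHom.zero_apply, smul_zero])
    hC₂ (j := j)
    (hker := fun s s' h ↦ ⟨hker s (by simpa using h), Subsingleton.elim _ _⟩)
    (hcoker := fun t ↦ by
      obtain ⟨s, hs⟩ := hcoker t
      exact ⟨s, PUnit.unit, by simpa using hs⟩)
    (hX₁ := hX₁) (hX₁' := fun x ↦ ⟨1, Subsingleton.elim _ _⟩)
  have h0 : lambdaInvariant p (PUnit : Type) = 0 := by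
    letI : Module ℤ_[p] (PUnit : Type) := Module.compHom PUnit (algebraMap ℤ_[p] (IwasawaAlgebra p))
    haveI : IsScalarTower ℤ_[p] (IwasawaAlgebra p) (PUnit : Type) := IsScalarTower.of_compHom ℤ_[p] _ _
    rw [lambdaInvariant_eq_finrank_tensorProduct]
    haveI : Subsingleton (ℚ_[p] ⊗[ℤ_[p]] (PUnit : Type)) := inferInstance
    exact Module.finrank_zero_of_subsingleton
  rw [h0, add_zero] at h
  exact h

end Comparison

end IwasawaDual

end Literature.NumberTheory.EllipticCurves

end
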